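import Literature.IUT.HodgeArakelov.TemperedFrobenioidDataOfBTemp
import Literature.IUT.HodgeArakelov.MonoThetaFromGroupsProp13Proofs
import HarnessLib

/-!
# [IUTchII] Proposition 1.3 (i) at the GENUINE `M^Θ(𝒞) = E^Π_N`: the exterior cyclotome ON THE NOSE

S. Mochizuki, *Inter-universal Teichmüller theory II*, §1, Proposition 1.3 (i), kurims manuscript (Dec. 2020)
p. 26 (read on the page, `paper:url-5036b4059555` p. 26 l. 10–24) [claim: Mochizuki2012, status: disputed]
(IUTchII §1 Prop 1.3 (i), kurims p.26): "For a suitable object `S ∈ Ob(𝒞)` [cf. [EtTh], Lemma 5.9, (v)] … the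
exterior cyclotome `Π_μ(M^Θ(𝒞))` corresponds to the subgroup `μ_N(S) ⊆ O^×(S) ⊆ Aut(S)`."  Printed proof
(p. 27): "Assertions (i), (ii) follow immediately from the results and definitions of [EtTh], [AbsTopIII] that
are quoted in the statements of these assertions."

abc-iut cell, DAG node `IUTchII:Prop1.3(i)` (cone of [IUTchIII] Cor. 3.12, LONG-CHAINS LC-L2-1), discharge seat
abc-iut-w4-d042 (gen 2), continuing this seat's `MonoThetaFromGroupsProp13Proofs.lean` (p411824).  There,
Prop. 1.3 (i) was PROVED "in shape" over abc-iut-L2-t4's [EtTh] §5 data with the exterior correspondence left as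
the NAMED PARAMETER `φ : E.recon.extCyc ≃* Ker(E^Π_N ↠ Π^tp_Y̲)` ("this is what '`M^Θ(𝒞)` constructed from
`𝒞`', [EtTh] Lemma 5.9 (iv) / Thm. 5.10 (iii), supplies").  This file DISCHARGES `φ`:

* `EnvOfFrobenioid.ofBiTheta` — the [IUTchII] Prop. 1.2 (ii) output `M^Θ(𝒞)` whose underlying [EtTh] datum is
  EXACTLY abc-iut-L2-t4's Frobenioid-theoretic mono-theta environment `E^Π_N` (`ThetaFrobenioid.frdMonoThetaEnv`,
  [EtTh] Lemma 5.9 (iv) "in particular") and whose Def. 1.1 (i) output (bridge B8 part 5b, abc-iut-L6-d6's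
  `ModelFrame.reconstruction`) is read THROUGH THE BI-THETA ISOMORPHISM `E^Π_N ⥲ Π^tp_Y[μ_N]` OF [EtTh] LEMMA
  5.9 (iv) — the datum `i` of abc-iut-L2-t4's typed `ThetaFrobenioid.EnvIsoBiTheta` (discharged in L2 modulo
  named inputs, `Discharge/Sec5BiThetaIso`, `envIsoBiTheta_of`) — rather than through an arbitrary identification
  with the model as in abc-iut-w5-d177's existence form `exists_envOfFrobenioid_frdMonoThetaEnv` (p414070),
  which it refines (`ofBiTheta_env_toEtale`, `ofBiTheta_indeterminacy`);
* `ofBiTheta_extCyc_eq_ker_toPiY` / `ofBiTheta_extCyc_eq_range_muIncl` — **for this output the exterior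
  cyclotome `Π_μ(M^Θ(𝒞)) := Ker(Π_{M^Θ(𝒞)} ↠ Π_Y(M^Θ(𝒞)))` (abc-iut-L6-t1's `Reconstruction.extCyc`) IS, as a
  subgroup of `E^Π_N`, the kernel of `E^Π_N ↠ Π^tp_Y̲`, i.e. the image of `μ_N(B_N) ↪ E^Π_N`, `u ↦ (u, 1)`**
  ([EtTh] Rmk. 5.10.3 "the distinct cyclotome `μ_N(B_N) ≅ Ker(E^Π_N ↠ Π^tp_Y)`", L2-t4's PROVED `toPiY_ker`):
  the printed "corresponds to the subgroup `μ_N(S) ⊆ O^×(S) ⊆ Aut(S)`" with `S := B_N` holds with the IDENTITY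
  as correspondence; the only input is the clause of Lemma 5.9 (iv) that the bi-theta isomorphism lies over
  `Π^tp_Y̲` (`hi`, the fourth conjunct of `EnvIsoBiTheta`);
* `corrExtOfBiTheta` — the resulting CANONICAL `Π_μ(M^Θ(𝒞)) ⥲ μ_N(B_N)` (`(corrExt x, 1) = x`), and
  `prop13_i_ii_ofBiTheta` — abc-iut-L6-t1's `Prop13_i_ii` for this output over the interface instance
  `TemperedFrobenioidData.ofThetaFrobenioid S 𝔉 e` of p414070 with `φ := id` and `hobj := rfl`, the remaining
  inputs being exactly those of p411824: `ψ` (the [EtTh] §2 ↔ §5 identification of `(l·Δ_Θ)`; §5's `(l·Δ_Θ)_E`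
  is abc-iut-L2-t4's ABSTRACT `ThetaSubquotientStub` — owner abc-iut-L2-t2/L2-t9) and the [AbsTopIII] data of
  Prop. 1.3 (ii) (parameters: [AbsTopIII] Cor. 1.10 is FACT-policy, plan/GAP-LEDGER G-w4d042-1);
* `EnvOfFrobenioid.ofEnvIsoBiTheta` and the `ofEnvIsoBiTheta_*` family — the same stated over abc-iut-L2-t4's
  `EnvIsoBiTheta` BY NAME (bi-theta isomorphism extracted by choice), for the [IUTchII] §1 setting BUILT from the
  rigidity datum (`ThetaSetting.ofThetaEnvData`, bridge B8 part 2 — the shape of the Tate-curve setting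
  `ofDoubleUnderline`), where the level `N` of the §5 data and of the setting agree syntactically (for a general
  setting `S` the two levels are distinct terms, whence the cocycle-indexed binders `hη`, `i`, `hi` above).

Hypotheses, all BY NAME (D-0067 (1): no `def … : Prop` here): bridge B8's `ModelFrame`/`ModelAgreement`, the
named [EtTh] facts `ThetaEnvData.Cor218_ii`, `RigidData.Cor218_iv_fibre`, abc-iut-L2-t4's §5 binders of
`frdMonoThetaEnv` (`SectionsFactor`, `OuterActionLZ`, `SgpCapSection`, `SgpCupSection`, `ConstantsEqNormalizer`),
and the Lemma 5.9 (iv) bi-theta isomorphism `i` with its compatibility `hi` (or `EnvIsoBiTheta` itself).  HONEST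
FRAMING: constructions and kernel-checked implications between typed statements ([EtTh] refereed; [IUTchII]
record-only, claim key `Mochizuki2012`, D-0012, disputed); nothing here bears on [IUTchIII] Cor. 3.12; no side
is taken; typed ≠ proved elsewhere.
-/

noncomputable section

namespace Literature.IUT.HodgeArakelov

universe w u

open CategoryTheory Literature.AnabelianGeometry.EtaleTheta
open scoped Literature.AnabelianGeometry.EtaleTheta

variable {S : ThetaSetting.{u}}

/-! ## An [EtTh] isomorphism re-sourced at the [IUTchII]-typed environment of its source -/

namespace MonoThetaEnv

/-- Bookkeeping for bridge B8 part 1 (`MonoThetaEnv.ofEtale`): an [EtTh] Def. 2.13 (ii) isomorphism `β : M' ⥲ X`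
IS an isomorphism from the underlying [EtTh] datum of the [IUTchII]-typed environment `ofEtale M' h` (whose
`D ⊆ Out` is `M'.D` read into `Aut` and back: `autToOut (outToAut D) = D`) — same underlying map.
[cite: MochizukiEtTh2009, Def 2.13(ii) p.47] -/
def isoOfEtale (M' : Literature.AnabelianGeometry.EtaleTheta.MonoThetaEnv.{u})
    (h : Nonempty (M'.Iso S.modelEnv)) {X : Literature.AnabelianGeometry.EtaleTheta.MonoThetaEnv.{u}}
    (β : M'.Iso X) : (MonoThetaEnv.ofEtale M' h).toEtale.Iso X where
  e := β.e
  map_D := by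
    change (autToOut M'.Pi (outToAut M'.Pi M'.D)).map (TopOut.transport β.e) = X.D
    rw [autToOut_outToAut]
    exact β.map_D
  map_sTheta := β.map_sTheta

/-- Same underlying map. [cite: MochizukiEtTh2009, Def 2.13(ii) p.47] -/
@[simp]
theorem isoOfEtale_e (M' : Literature.AnabelianGeometry.EtaleTheta.MonoThetaEnv.{u})
    (h : Nonempty (M'.Iso S.modelEnv)) {X : Literature.AnabelianGeometry.EtaleTheta.MonoThetaEnv.{u}}
    (β : M'.Iso X) : (isoOfEtale M' h β).e = β.e := rfl

end MonoThetaEnv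

/-! ## The Prop. 1.2 (ii) output read through the bi-theta isomorphism of [EtTh] Lemma 5.9 (iv) -/

section BiTheta

variable {l : ℕ} {R : RigidData.{u} S.N l}
variable {C : Type (u + 1)} [Category.{u} C] {D : Type (u + 1)} [Category.{u} D]
  (𝔉 : ThetaFrobenioid.{w} C D) (h1 : 𝔉.SectionsFactor) (h3 : 𝔉.OuterActionLZ)
  (hsec : 𝔉.SgpCapSection) (hcs : 𝔉.SgpCupSection) (h8 : 𝔉.ConstantsEqNormalizer)
  (DK : Set (TopOut 𝔉.EPiN))

/-- [EtTh] Lemma 5.9 (iv) "in particular": a bi-theta isomorphism `E^Π_N ⥲ Π^tp_Y[μ_N]` exhibits `E^Π_N`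
(`s^⊓-Π_N` omitted) as a mod `N` mono-theta environment of `R` (abc-iut-L2-t4's `frdIsMonoThetaEnv_of`,
cocycle-indexed form). [cite: MochizukiEtTh2009, Lem 5.9 (iv) p.332 (PDF p.106)] -/
theorem isMonoThetaEnv_frdMonoThetaEnv_of_biThetaIso {η : R.PiYdd → R.mu} (hη : η ∈ R.thetaCocycles)
    (i : (𝔉.frdBiThetaEnv h1 h3 hsec hcs h8 DK).Iso (R.toThetaEnvData.modelBi hη)) :
    R.toThetaEnvData.IsMonoThetaEnv (𝔉.frdMonoThetaEnv h1 h3 hsec hcs h8 DK) :=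
  ⟨η, hη, ⟨i.toMonoIso⟩⟩

/-- **`M^Θ(𝒞)` as an [IUTchII]-typed mono-theta environment of the setting `S`**: abc-iut-L2-t4's `E^Π_N`
(`frdMonoThetaEnv`) re-bundled by bridge B8 (`MonoThetaEnv.ofIsMonoThetaEnv`, modulo the named fact
[EtTh] Cor. 2.18 (ii)). [claim: Mochizuki2012, status: disputed] (IUTchII §1 Prop 1.2 (ii), kurims pp.25-26) -/
def envOfBiTheta (h218ii : R.toThetaEnvData.Cor218_ii) (A : ModelAgreement S R.toThetaEnvData)
    {η : R.PiYdd → R.mu} (hη : η ∈ R.thetaCocycles)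
    (i : (𝔉.frdBiThetaEnv h1 h3 hsec hcs h8 DK).Iso (R.toThetaEnvData.modelBi hη)) : MonoThetaEnv S :=
  MonoThetaEnv.ofIsMonoThetaEnv h218ii A (𝔉.frdMonoThetaEnv h1 h3 hsec hcs h8 DK)
    (isMonoThetaEnv_frdMonoThetaEnv_of_biThetaIso 𝔉 h1 h3 hsec hcs h8 DK hη i)

/-- The underlying [EtTh] datum of `envOfBiTheta` is `E^Π_N` ON THE NOSE.
[claim: Mochizuki2012, status: disputed] (IUTchII §1 Prop 1.2 (ii), kurims pp.25-26) -/
theorem envOfBiTheta_toEtale (h218ii : R.toThetaEnvData.Cor218_ii) (A : ModelAgreement S R.toThetaEnvData)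
    {η : R.PiYdd → R.mu} (hη : η ∈ R.thetaCocycles)
    (i : (𝔉.frdBiThetaEnv h1 h3 hsec hcs h8 DK).Iso (R.toThetaEnvData.modelBi hη)) :
    (envOfBiTheta 𝔉 h1 h3 hsec hcs h8 DK h218ii A hη i).toEtale = 𝔉.frdMonoThetaEnv h1 h3 hsec hcs h8 DK :=
  MonoThetaEnv.toEtale_ofEtale (𝔉.frdMonoThetaEnv h1 h3 hsec hcs h8 DK)
    (nonempty_iso_modelEnv_of_isMonoThetaEnv h218ii A _
      (isMonoThetaEnv_frdMonoThetaEnv_of_biThetaIso 𝔉 h1 h3 hsec hcs h8 DK hη i))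

/-- The bi-theta isomorphism of Lemma 5.9 (iv), with `s^alg` omitted, as an [EtTh] isomorphism from the
underlying datum of `envOfBiTheta` to the model mono-theta environment `Π^tp_Y[μ_N]` of `R` at the cocycle `η`.
[cite: MochizukiEtTh2009, Lem 5.9 (iv) p.332 (PDF p.106)] -/
def isoModelOfBiTheta (h218ii : R.toThetaEnvData.Cor218_ii) (A : ModelAgreement S R.toThetaEnvData)
    {η : R.PiYdd → R.mu} (hη : η ∈ R.thetaCocycles)
    (i : (𝔉.frdBiThetaEnv h1 h3 hsec hcs h8 DK).Iso (R.toThetaEnvData.modelBi hη)) :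
    (envOfBiTheta 𝔉 h1 h3 hsec hcs h8 DK h218ii A hη i).toEtale.Iso (R.modelMono hη) :=
  MonoThetaEnv.isoOfEtale (𝔉.frdMonoThetaEnv h1 h3 hsec hcs h8 DK)
    (nonempty_iso_modelEnv_of_isMonoThetaEnv h218ii A _
      (isMonoThetaEnv_frdMonoThetaEnv_of_biThetaIso 𝔉 h1 h3 hsec hcs h8 DK hη i))
    i.toMonoIso

/-- Its underlying map is that of `i`. [cite: MochizukiEtTh2009, Lem 5.9 (iv) p.332 (PDF p.106)] -/
@[simp]
theorem isoModelOfBiTheta_e (h218ii : R.toThetaEnvData.Cor218_ii) (A : ModelAgreement S R.toThetaEnvData)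
    {η : R.PiYdd → R.mu} (hη : η ∈ R.thetaCocycles)
    (i : (𝔉.frdBiThetaEnv h1 h3 hsec hcs h8 DK).Iso (R.toThetaEnvData.modelBi hη)) :
    (isoModelOfBiTheta 𝔉 h1 h3 hsec hcs h8 DK h218ii A hη i).e = i.e := rfl

/-- **[IUTchII] Prop. 1.2 (ii) OUTPUT `M^Θ(𝒞)` READ THROUGH THE BI-THETA ISOMORPHISM** (for any instance `Fr` of
abc-iut-L6-t1's interface `TemperedFrobenioidData S`): `M^Θ(𝒞) := E^Π_N`, the Def. 1.1 (i) output := bridge B8's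
`ModelFrame.reconstruction` along `i : E^Π_N ⥲ Π^tp_Y[μ_N]` (so `Π_{M^Θ(𝒞)} ↠ Π_Y(M^Θ(𝒞))` is
`E^Π_N ⥲ Π^tp_Y[μ_N] ↠ Π^tp_Y`), and `𝒟 ≌ B^temp(Π^tp_{X̲̲_k})⁰ ≌ B^temp(Π_X(M^Θ(𝒞)))⁰` by transport along the frame.
[claim: Mochizuki2012, status: disputed] (IUTchII §1 Prop 1.2 (ii), kurims pp.25-26) -/
def EnvOfFrobenioid.ofBiTheta (h218ii : R.toThetaEnvData.Cor218_ii) (A : ModelAgreement S R.toThetaEnvData)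
    {η : R.PiYdd → R.mu} (hη : η ∈ R.thetaCocycles)
    (i : (𝔉.frdBiThetaEnv h1 h3 hsec hcs h8 DK).Iso (R.toThetaEnvData.modelBi hη))
    (F : ModelFrame S R) (Fr : TemperedFrobenioidData S) : EnvOfFrobenioid Fr where
  env := envOfBiTheta 𝔉 h1 h3 hsec hcs h8 DK h218ii A hη i
  recon := F.reconstruction (isoModelOfBiTheta 𝔉 h1 h3 hsec hcs h8 DK h218ii A hη i).e
  baseEquiv := Fr.baseEquiv.trans (Fr.Btemp0_map F.eX.symm)

/-- `M^Θ(𝒞)` of the output has underlying [EtTh] datum EXACTLY `E^Π_N` (the clause of abc-iut-w5-d177's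
`exists_envOfFrobenioid_frdMonoThetaEnv`). [claim: Mochizuki2012, status: disputed] (IUTchII §1 Prop 1.2 (ii), kurims pp.25-26) -/
theorem ofBiTheta_env_toEtale (h218ii : R.toThetaEnvData.Cor218_ii) (A : ModelAgreement S R.toThetaEnvData)
    {η : R.PiYdd → R.mu} (hη : η ∈ R.thetaCocycles)
    (i : (𝔉.frdBiThetaEnv h1 h3 hsec hcs h8 DK).Iso (R.toThetaEnvData.modelBi hη))
    (F : ModelFrame S R) (Fr : TemperedFrobenioidData S) :
    (EnvOfFrobenioid.ofBiTheta 𝔉 h1 h3 hsec hcs h8 DK h218ii A hη i F Fr).env.toEtale =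
      𝔉.frdMonoThetaEnv h1 h3 hsec hcs h8 DK :=
  envOfBiTheta_toEtale 𝔉 h1 h3 hsec hcs h8 DK h218ii A hη i

/-- **[IUTchII] Prop. 1.2 (i) indeterminacy clause for the output** ("a group of `μ_N`-conjugacy classes of
automorphisms which is of order `1` (respectively, `2`) if `N` is odd (respectively, even)"), modulo the named
[EtTh] fact Cor. 2.18 (iv) (abc-iut-w4-d008's `prop12_i_indeterminacy_reconstruction`).
[claim: Mochizuki2012, status: disputed] (IUTchII §1 Prop 1.2 (i), kurims p.25) -/
theorem ofBiTheta_indeterminacy (h218ii : R.toThetaEnvData.Cor218_ii) (A : ModelAgreement S R.toThetaEnvData)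
    {η : R.PiYdd → R.mu} (hη : η ∈ R.thetaCocycles)
    (i : (𝔉.frdBiThetaEnv h1 h3 hsec hcs h8 DK).Iso (R.toThetaEnvData.modelBi hη))
    (F : ModelFrame S R) (Fr : TemperedFrobenioidData S) (hfib : R.Cor218_iv_fibre) :
    Prop12_i_indeterminacy (EnvOfFrobenioid.ofBiTheta 𝔉 h1 h3 hsec hcs h8 DK h218ii A hη i F Fr).recon :=
  prop12_i_indeterminacy_reconstruction F hfib hη (isoModelOfBiTheta 𝔉 h1 h3 hsec hcs h8 DK h218ii A hη i)

/-- The existence form of abc-iut-w5-d177 (p414070) recovered. [claim: Mochizuki2012, status: disputed] -/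
theorem exists_envOfFrobenioid_of_biThetaIso (h218ii : R.toThetaEnvData.Cor218_ii) (A : ModelAgreement S R.toThetaEnvData)
    {η : R.PiYdd → R.mu} (hη : η ∈ R.thetaCocycles)
    (i : (𝔉.frdBiThetaEnv h1 h3 hsec hcs h8 DK).Iso (R.toThetaEnvData.modelBi hη))
    (F : ModelFrame S R) (Fr : TemperedFrobenioidData S) (hfib : R.Cor218_iv_fibre) :
    ∃ E : EnvOfFrobenioid Fr,
      E.env.toEtale = 𝔉.frdMonoThetaEnv h1 h3 hsec hcs h8 DK ∧ Prop12_i_indeterminacy E.recon :=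
  ⟨EnvOfFrobenioid.ofBiTheta 𝔉 h1 h3 hsec hcs h8 DK h218ii A hη i F Fr,
    ofBiTheta_env_toEtale 𝔉 h1 h3 hsec hcs h8 DK h218ii A hη i F Fr,
    ofBiTheta_indeterminacy 𝔉 h1 h3 hsec hcs h8 DK h218ii A hη i F Fr hfib⟩

/-! ### The exterior cyclotome of the output, ON THE NOSE -/

/-- `Π_{M^Θ(𝒞)} ↠ Π_Y(M^Θ(𝒞))` of the output is `E^Π_N ⥲ Π^tp_Y[μ_N] ↠ Π^tp_Y`. [claim: Mochizuki2012, status: disputed] -/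
theorem ofBiTheta_projY_apply (h218ii : R.toThetaEnvData.Cor218_ii) (A : ModelAgreement S R.toThetaEnvData)
    {η : R.PiYdd → R.mu} (hη : η ∈ R.thetaCocycles)
    (i : (𝔉.frdBiThetaEnv h1 h3 hsec hcs h8 DK).Iso (R.toThetaEnvData.modelBi hη))
    (F : ModelFrame S R) (Fr : TemperedFrobenioidData S) (x : 𝔉.EPiN) :
    (EnvOfFrobenioid.ofBiTheta 𝔉 h1 h3 hsec hcs h8 DK h218ii A hη i F Fr).recon.projY x =
      CycEnvelope.proj R.augY R.chi (i.e x) :=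
  rfl

/-- **IUTchII:Prop1.3(i), exterior clause, at the genuine `M^Θ(𝒞)`** — membership form: an element of
`Π_{M^Θ(𝒞)} = E^Π_N` lies in the exterior cyclotome `Π_μ(M^Θ(𝒞)) = Ker(Π_{M^Θ(𝒞)} ↠ Π_Y(M^Θ(𝒞)))` iff it lies in
`Ker(E^Π_N ↠ Π^tp_Y̲)`; input: the bi-theta isomorphism lies over `Π^tp_Y̲` (`hi`, [EtTh] Lemma 5.9 (iv)).
[claim: Mochizuki2012, status: disputed] (IUTchII §1 Prop 1.3 (i), kurims p.26) -/
theorem mem_ofBiTheta_extCyc_iff (h218ii : R.toThetaEnvData.Cor218_ii) (A : ModelAgreement S R.toThetaEnvData)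
    {η : R.PiYdd → R.mu} (hη : η ∈ R.thetaCocycles)
    (i : (𝔉.frdBiThetaEnv h1 h3 hsec hcs h8 DK).Iso (R.toThetaEnvData.modelBi hη))
    (F : ModelFrame S R) (Fr : TemperedFrobenioidData S) (ι : 𝔉.PiX ≃ₜ* R.PiX)
    (hi : ∀ x : 𝔉.EPiN, ((CycEnvelope.proj R.augY R.chi (i.e x) : R.PiY) : R.PiX) = ι (𝔉.toPiY x)) (x : 𝔉.EPiN) :
    x ∈ (EnvOfFrobenioid.ofBiTheta 𝔉 h1 h3 hsec hcs h8 DK h218ii A hη i F Fr).recon.extCyc ↔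
      𝔉.toPiY x = 1 := by
  change CycEnvelope.proj R.augY R.chi (i.e x) = 1 ↔ _
  rw [← Subtype.coe_inj, OneMemClass.coe_one, hi x, map_eq_one_iff _ ι.injective]

/-- **IUTchII:Prop1.3(i), exterior clause, at the genuine `M^Θ(𝒞)`**: `Π_μ(M^Θ(𝒞)) = Ker(E^Π_N ↠ Π^tp_Y̲)` as
subgroups of `E^Π_N`. [claim: Mochizuki2012, status: disputed] (IUTchII §1 Prop 1.3 (i), kurims p.26) -/
theorem ofBiTheta_extCyc_eq_ker_toPiY (h218ii : R.toThetaEnvData.Cor218_ii) (A : ModelAgreement S R.toThetaEnvData)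
    {η : R.PiYdd → R.mu} (hη : η ∈ R.thetaCocycles)
    (i : (𝔉.frdBiThetaEnv h1 h3 hsec hcs h8 DK).Iso (R.toThetaEnvData.modelBi hη))
    (F : ModelFrame S R) (Fr : TemperedFrobenioidData S) (ι : 𝔉.PiX ≃ₜ* R.PiX)
    (hi : ∀ x : 𝔉.EPiN, ((CycEnvelope.proj R.augY R.chi (i.e x) : R.PiY) : R.PiX) = ι (𝔉.toPiY x)) :
    (EnvOfFrobenioid.ofBiTheta 𝔉 h1 h3 hsec hcs h8 DK h218ii A hη i F Fr).recon.extCyc = 𝔉.toPiY.ker :=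
  Subgroup.ext fun x =>
    (mem_ofBiTheta_extCyc_iff 𝔉 h1 h3 hsec hcs h8 DK h218ii A hη i F Fr ι hi x).trans MonoidHom.mem_ker.symm

/-- **IUTchII:Prop1.3(i), exterior clause, at the genuine `M^Θ(𝒞)`** ("the exterior cyclotome `Π_μ(M^Θ(𝒞))`
corresponds to the subgroup `μ_N(S) ⊆ O^×(S) ⊆ Aut(S)`", `S := B_N`): `Π_μ(M^Θ(𝒞))` IS the image of
`μ_N(B_N) ↪ E^Π_N`, `u ↦ (u, 1)` ([EtTh] Rmk. 5.10.3 "the distinct cyclotome", abc-iut-L2-t4's `toPiY_ker`).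
[claim: Mochizuki2012, status: disputed] (IUTchII §1 Prop 1.3 (i), kurims p.26) -/
theorem ofBiTheta_extCyc_eq_range_muIncl (h218ii : R.toThetaEnvData.Cor218_ii) (A : ModelAgreement S R.toThetaEnvData)
    {η : R.PiYdd → R.mu} (hη : η ∈ R.thetaCocycles)
    (i : (𝔉.frdBiThetaEnv h1 h3 hsec hcs h8 DK).Iso (R.toThetaEnvData.modelBi hη))
    (F : ModelFrame S R) (Fr : TemperedFrobenioidData S) (ι : 𝔉.PiX ≃ₜ* R.PiX)
    (hi : ∀ x : 𝔉.EPiN, ((CycEnvelope.proj R.augY R.chi (i.e x) : R.PiY) : R.PiX) = ι (𝔉.toPiY x)) :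
    (EnvOfFrobenioid.ofBiTheta 𝔉 h1 h3 hsec hcs h8 DK h218ii A hη i F Fr).recon.extCyc = 𝔉.muIncl.range :=
  (ofBiTheta_extCyc_eq_ker_toPiY 𝔉 h1 h3 hsec hcs h8 DK h218ii A hη i F Fr ι hi).trans (𝔉.toPiY_ker hsec)

/-- `μ_N(B_N) ↪ E^Π_N`, `u ↦ (u, 1)`, is injective. [cite: MochizukiEtTh2009, Lem 5.9 (iv) p.332 (PDF p.106)] -/
theorem muIncl_injective : Function.Injective 𝔉.muIncl := fun u v h => Subtype.ext (by
  simpa only [ThetaFrobenioid.coe_muIncl] using congrArg (fun y : 𝔉.EPiN => ((y : Aut 𝔉.BN × 𝔉.PiX)).1) h)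

/-- **The CANONICAL exterior correspondence `Π_μ(M^Θ(𝒞)) ⥲ μ_N(B_N)`** of Prop. 1.3 (i) at the genuine `M^Θ(𝒞)`:
the inverse of `u ↦ (u, 1)` on its image. [claim: Mochizuki2012, status: disputed] (IUTchII §1 Prop 1.3 (i), kurims p.26) -/
def corrExtOfBiTheta (h218ii : R.toThetaEnvData.Cor218_ii) (A : ModelAgreement S R.toThetaEnvData)
    {η : R.PiYdd → R.mu} (hη : η ∈ R.thetaCocycles)
    (i : (𝔉.frdBiThetaEnv h1 h3 hsec hcs h8 DK).Iso (R.toThetaEnvData.modelBi hη))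
    (F : ModelFrame S R) (Fr : TemperedFrobenioidData S) (ι : 𝔉.PiX ≃ₜ* R.PiX)
    (hi : ∀ x : 𝔉.EPiN, ((CycEnvelope.proj R.augY R.chi (i.e x) : R.PiY) : R.PiX) = ι (𝔉.toPiY x)) :
    (EnvOfFrobenioid.ofBiTheta 𝔉 h1 h3 hsec hcs h8 DK h218ii A hη i F Fr).recon.extCyc ≃*
      𝔉.muTorsion 𝔉.BN 𝔉.N :=
  (MulEquiv.subgroupCongr (ofBiTheta_extCyc_eq_range_muIncl 𝔉 h1 h3 hsec hcs h8 DK h218ii A hη i F Fr ι hi)).trans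
    (MonoidHom.ofInjective (muIncl_injective 𝔉)).symm

/-- The canonical correspondence is the identity on underlying elements of `E^Π_N`: `(corrExt x, 1) = x`.
[claim: Mochizuki2012, status: disputed] (IUTchII §1 Prop 1.3 (i), kurims p.26) -/
theorem muIncl_corrExtOfBiTheta (h218ii : R.toThetaEnvData.Cor218_ii) (A : ModelAgreement S R.toThetaEnvData)
    {η : R.PiYdd → R.mu} (hη : η ∈ R.thetaCocycles)
    (i : (𝔉.frdBiThetaEnv h1 h3 hsec hcs h8 DK).Iso (R.toThetaEnvData.modelBi hη))
    (F : ModelFrame S R) (Fr : TemperedFrobenioidData S) (ι : 𝔉.PiX ≃ₜ* R.PiX)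
    (hi : ∀ x : 𝔉.EPiN, ((CycEnvelope.proj R.augY R.chi (i.e x) : R.PiY) : R.PiX) = ι (𝔉.toPiY x))
    (x : (EnvOfFrobenioid.ofBiTheta 𝔉 h1 h3 hsec hcs h8 DK h218ii A hη i F Fr).recon.extCyc) :
    𝔉.muIncl (corrExtOfBiTheta 𝔉 h1 h3 hsec hcs h8 DK h218ii A hη i F Fr ι hi x) = x.1 := by
  have hx : (x.1 : 𝔉.EPiN) ∈ 𝔉.muIncl.range :=
    (ofBiTheta_extCyc_eq_range_muIncl 𝔉 h1 h3 hsec hcs h8 DK h218ii A hη i F Fr ι hi).le x.2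
  obtain ⟨u, hu⟩ := hx
  have he : corrExtOfBiTheta 𝔉 h1 h3 hsec hcs h8 DK h218ii A hη i F Fr ι hi x = u := by
    apply (MonoidHom.ofInjective (muIncl_injective 𝔉)).injective
    change (MonoidHom.ofInjective (muIncl_injective 𝔉)) ((MonoidHom.ofInjective (muIncl_injective 𝔉)).symm
      (MulEquiv.subgroupCongr _ x)) = _
    rw [MulEquiv.apply_symm_apply]
    apply Subtype.ext
    rw [MonoidHom.ofInjective_apply, hu]
    rfl
  rw [he, hu]

/-- The bi-theta isomorphism carries the exterior cyclotome of `M^Θ(𝒞)` INTO `μ_N ⊆ Π^tp_Y[μ_N]` (the last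
clause of [EtTh] Lemma 5.9 (iv) as typed: "carrying `μ_N(B_N)` into `μ_N`").
[cite: MochizukiEtTh2009, Lem 5.9 (iv) p.332 (PDF p.106)] -/
theorem biThetaIso_extCyc_mem_range_inMu (h218ii : R.toThetaEnvData.Cor218_ii) (A : ModelAgreement S R.toThetaEnvData)
    {η : R.PiYdd → R.mu} (hη : η ∈ R.thetaCocycles)
    (i : (𝔉.frdBiThetaEnv h1 h3 hsec hcs h8 DK).Iso (R.toThetaEnvData.modelBi hη))
    (F : ModelFrame S R) (Fr : TemperedFrobenioidData S) (ι : 𝔉.PiX ≃ₜ* R.PiX)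
    (hi : ∀ x : 𝔉.EPiN, ((CycEnvelope.proj R.augY R.chi (i.e x) : R.PiY) : R.PiX) = ι (𝔉.toPiY x))
    (hμ : ∀ u : 𝔉.muTorsion 𝔉.BN 𝔉.N, i.e (𝔉.muIncl u) ∈ (CycEnvelope.inMu R.augY R.chi).range)
    (x : (EnvOfFrobenioid.ofBiTheta 𝔉 h1 h3 hsec hcs h8 DK h218ii A hη i F Fr).recon.extCyc) :
    i.e x.1 ∈ (CycEnvelope.inMu R.augY R.chi).range := by
  have h := hμ (corrExtOfBiTheta 𝔉 h1 h3 hsec hcs h8 DK h218ii A hη i F Fr ι hi x)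
  rwa [muIncl_corrExtOfBiTheta 𝔉 h1 h3 hsec hcs h8 DK h218ii A hη i F Fr ι hi x] at h

/-! ### Prop. 1.3 (i)–(ii) for the output over the interface instance of the §5 data -/

/-- **IUTchII:Prop1.3(i)–(ii) for the GENUINE `M^Θ(𝒞) = E^Π_N`** over the Prop. 1.2 (ii) interface INSTANCE of
the §5 data (abc-iut-w5-d177's `TemperedFrobenioidData.ofThetaFrobenioid S 𝔉 e`: `𝒞 := 𝒞`, base functor `𝔉.base`,
`e : 𝒟 ≌ B^temp(Π^tp_{X̲̲_k})⁰`): abc-iut-L6-t1's `Prop13_i_ii` holds with `S := B_N`, `μ_N(S) := μ_N(B_N)`,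
`O^×(S) := O^×(B_N)`, the exterior correspondence the IDENTITY (`ofBiTheta_extCyc_eq_ker_toPiY`) and the interior
subquotient SOURCED from abc-iut-L2-t4's `ThetaSubquotientProj 𝔉` at `B_N^bs` with NO base-agreement hypothesis
(`hobj := rfl`).  Remaining inputs, exactly as in p411824: `ψ` (the [EtTh] §2 ↔ §5 identification of
`(l·Δ_Θ) ⊗ ℤ/Nℤ`: bridge B8's interior cyclotome of the model vs. the §5 stub `(l·Δ_Θ)_{B_N}`) and the [AbsTopIII]
data of (ii) (`i₁` Cor. 1.10 (c), `i₂` Rmk. 3.2.1, `c₁`, `c₂`).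
[claim: Mochizuki2012, status: disputed] (IUTchII §1 Prop 1.3 (i)(ii), kurims p.26) -/
theorem prop13_i_ii_ofBiTheta (h218ii : R.toThetaEnvData.Cor218_ii) (A : ModelAgreement S R.toThetaEnvData)
    {η : R.PiYdd → R.mu} (hη : η ∈ R.thetaCocycles)
    (i : (𝔉.frdBiThetaEnv h1 h3 hsec hcs h8 DK).Iso (R.toThetaEnvData.modelBi hη))
    (F : ModelFrame S R) (ι : 𝔉.PiX ≃ₜ* R.PiX)
    (hi : ∀ x : 𝔉.EPiN, ((CycEnvelope.proj R.augY R.chi (i.e x) : R.PiY) : R.PiX) = ι (𝔉.toPiY x)) (e : D ≌ BTemp0 S.PiX) (Pj : FrobenioidCyclotomicRigidity.ThetaSubquotientProj 𝔉)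
    (ψ : ModPow (ModelCyclotomes.intCyc R).carrier (S.N : ℕ) ≃* 𝔉.lDeltaModN 𝔉.BN)
    {MTM Gc PX : Type u} [Group MTM] [Group Gc] [Group PX]
    (i₁ : Gc ≃* PX) (i₂ : MTM ≃* Gc) (c₁ : 𝔉.muTorsion 𝔉.BN 𝔉.N ≃* MTM)
    (c₂ : 𝔉.lDeltaModN 𝔉.BN ≃* PX) :
    Prop13_i_ii (EnvOfFrobenioid.ofBiTheta 𝔉 h1 h3 hsec hcs h8 DK h218ii A hη i F
      (TemperedFrobenioidData.ofThetaFrobenioid S 𝔉 e)) :=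
  prop13_i_ii_of_thetaSubquotientProj _ 𝔉 hsec Pj rfl
    (MulEquiv.subgroupCongr (ofBiTheta_extCyc_eq_ker_toPiY 𝔉 h1 h3 hsec hcs h8 DK h218ii A hη i F _ ι hi))
    ψ i₁ i₂ c₁ c₂

end BiTheta

/-! ## The same over abc-iut-L2-t4's Lemma 5.9 (iv) BY NAME, for the setting built from the rigidity datum -/

section OfEnvIsoBiTheta

variable {C : Type (u + 1)} [Category.{u} C] {D : Type (u + 1)} [Category.{u} D]
  (𝔉 : ThetaFrobenioid.{w} C D) (h1 : 𝔉.SectionsFactor) (h3 : 𝔉.OuterActionLZ)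
  (hsec : 𝔉.SgpCapSection) (hcs : 𝔉.SgpCupSection) (h8 : 𝔉.ConstantsEqNormalizer)
  (DK : Set (TopOut 𝔉.EPiN))
  {l : ℕ} {R : RigidData.{u} 𝔉.N l} [TopologicalSpace R.G] [IsTopologicalGroup R.G]
  (X : ThetaSetting.SideData R.toThetaEnvData)
  (F : ModelFrame (ThetaSetting.ofThetaEnvData R.toThetaEnvData X) R)
  (h218ii : R.toThetaEnvData.Cor218_ii) (ι : 𝔉.PiX ≃ₜ* R.PiX)
  (h59iv : 𝔉.EnvIsoBiTheta h1 h3 hsec hcs h8 DK R.toThetaEnvData ι)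
  (Fr : TemperedFrobenioidData (ThetaSetting.ofThetaEnvData R.toThetaEnvData X))

/-- **The Prop. 1.2 (ii) output `M^Θ(𝒞) = E^Π_N` from [EtTh] Lemma 5.9 (iv) BY NAME** (abc-iut-L2-t4's
`ThetaFrobenioid.EnvIsoBiTheta`, whose bi-theta isomorphism is extracted by choice), for the [IUTchII] §1
setting BUILT from the rigidity datum `R` (bridge B8 part 2 `ThetaSetting.ofThetaEnvData`, where
`ModelAgreement` holds by construction and the level of the setting is that of the §5 data), modulo the named
fact [EtTh] Cor. 2.18 (ii). [claim: Mochizuki2012, status: disputed] (IUTchII §1 Prop 1.2 (ii), kurims pp.25-26) -/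
def EnvOfFrobenioid.ofEnvIsoBiTheta : EnvOfFrobenioid Fr :=
  EnvOfFrobenioid.ofBiTheta 𝔉 h1 h3 hsec hcs h8 DK h218ii
    (ThetaSetting.modelAgreement_ofThetaEnvData R.toThetaEnvData X) h59iv.2.2.choose_spec.choose
    h59iv.2.2.choose_spec.choose_spec.choose F Fr

/-- Its `M^Θ(𝒞)` has underlying [EtTh] datum EXACTLY `E^Π_N`.
[claim: Mochizuki2012, status: disputed] (IUTchII §1 Prop 1.2 (ii), kurims pp.25-26) -/
theorem ofEnvIsoBiTheta_env_toEtale :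
    (EnvOfFrobenioid.ofEnvIsoBiTheta 𝔉 h1 h3 hsec hcs h8 DK X F h218ii ι h59iv Fr).env.toEtale =
      𝔉.frdMonoThetaEnv h1 h3 hsec hcs h8 DK :=
  ofBiTheta_env_toEtale 𝔉 h1 h3 hsec hcs h8 DK h218ii _ _ _ F Fr

/-- Its Def. 1.1 (i) output has the Prop. 1.2 (i) isomorphism indeterminacy (modulo [EtTh] Cor. 2.18 (iv)).
[claim: Mochizuki2012, status: disputed] (IUTchII §1 Prop 1.2 (i), kurims p.25) -/
theorem ofEnvIsoBiTheta_indeterminacy (hfib : R.Cor218_iv_fibre) :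
    Prop12_i_indeterminacy (EnvOfFrobenioid.ofEnvIsoBiTheta 𝔉 h1 h3 hsec hcs h8 DK X F h218ii ι h59iv Fr).recon :=
  ofBiTheta_indeterminacy 𝔉 h1 h3 hsec hcs h8 DK h218ii _ _ _ F Fr hfib

/-- **IUTchII:Prop1.3(i), exterior clause, at the genuine `M^Θ(𝒞)`, from [EtTh] Lemma 5.9 (iv) BY NAME**:
`Π_μ(M^Θ(𝒞)) = Ker(E^Π_N ↠ Π^tp_Y̲)` as subgroups of `E^Π_N`.
[claim: Mochizuki2012, status: disputed] (IUTchII §1 Prop 1.3 (i), kurims p.26) -/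
theorem ofEnvIsoBiTheta_extCyc_eq_ker_toPiY :
    (EnvOfFrobenioid.ofEnvIsoBiTheta 𝔉 h1 h3 hsec hcs h8 DK X F h218ii ι h59iv Fr).recon.extCyc =
      𝔉.toPiY.ker :=
  ofBiTheta_extCyc_eq_ker_toPiY 𝔉 h1 h3 hsec hcs h8 DK h218ii _ _ _ F Fr ι
    h59iv.2.2.choose_spec.choose_spec.choose_spec.1

/-- **IUTchII:Prop1.3(i), exterior clause, at the genuine `M^Θ(𝒞)`, from [EtTh] Lemma 5.9 (iv) BY NAME**:
`Π_μ(M^Θ(𝒞))` IS the image of `μ_N(B_N) ↪ E^Π_N` ("corresponds to the subgroup `μ_N(S) ⊆ O^×(S) ⊆ Aut(S)`").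
[claim: Mochizuki2012, status: disputed] (IUTchII §1 Prop 1.3 (i), kurims p.26) -/
theorem ofEnvIsoBiTheta_extCyc_eq_range_muIncl :
    (EnvOfFrobenioid.ofEnvIsoBiTheta 𝔉 h1 h3 hsec hcs h8 DK X F h218ii ι h59iv Fr).recon.extCyc =
      𝔉.muIncl.range :=
  ofBiTheta_extCyc_eq_range_muIncl 𝔉 h1 h3 hsec hcs h8 DK h218ii _ _ _ F Fr ι
    h59iv.2.2.choose_spec.choose_spec.choose_spec.1

/-- **IUTchII:Prop1.3(i)–(ii) for the genuine `M^Θ(𝒞)` from [EtTh] Lemma 5.9 (iv) BY NAME**, over the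
interface instance of the §5 data (`TemperedFrobenioidData.ofThetaFrobenioid`): `Prop13_i_ii` with the exterior
correspondence the identity and `hobj := rfl`; remaining inputs `ψ` (interior, §2 ↔ §5 stub identification)
and the [AbsTopIII] data of (ii). [claim: Mochizuki2012, status: disputed] (IUTchII §1 Prop 1.3 (i)(ii), kurims p.26) -/
theorem prop13_i_ii_ofEnvIsoBiTheta (e : D ≌ BTemp0 (ThetaSetting.ofThetaEnvData R.toThetaEnvData X).PiX)
    (Pj : FrobenioidCyclotomicRigidity.ThetaSubquotientProj 𝔉)
    (ψ : ModPow (ModelCyclotomes.intCyc R).carrier (𝔉.N : ℕ) ≃* 𝔉.lDeltaModN 𝔉.BN)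
    {MTM Gc PX : Type u} [Group MTM] [Group Gc] [Group PX]
    (i₁ : Gc ≃* PX) (i₂ : MTM ≃* Gc) (c₁ : 𝔉.muTorsion 𝔉.BN 𝔉.N ≃* MTM)
    (c₂ : 𝔉.lDeltaModN 𝔉.BN ≃* PX) :
    Prop13_i_ii (EnvOfFrobenioid.ofEnvIsoBiTheta 𝔉 h1 h3 hsec hcs h8 DK X F h218ii ι h59iv
      (TemperedFrobenioidData.ofThetaFrobenioid _ 𝔉 e)) :=
  prop13_i_ii_ofBiTheta 𝔉 h1 h3 hsec hcs h8 DK h218ii _ _ _ F ι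
    h59iv.2.2.choose_spec.choose_spec.choose_spec.1 e Pj ψ i₁ i₂ c₁ c₂

end OfEnvIsoBiTheta

end Literature.IUT.HodgeArakelov

end
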